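import Summits.CriticalPhenomena.Ising3DConformalLimit.Theses.IsingEuclidUpgrade
import Summits.CriticalPhenomena.Ising3DConformalLimit.Theses.HyperoctahedralRP

/-! Sketch for crux idea `sphere-uniformity-isotropy-transfer` (crux stmt-CriticalPhenomena-0634):
the first lemma of the line — lattice RATIO isotropy (stub_ratioIsotropy / child D2) from the EXISTENCE of a
full scaling limit (item 1981 `HyperoctahedralRP.ExistsScaleCovariantLimit`), via unit-sphere local uniformity and
the landed continuum isotropy `HyperoctahedralRPTwoPoint.kernel_rotation_invariant`. Statement only. -/

namespace Summit.CriticalPhenomena.Ising3DConformalLimit.Cruxes.IsingEuclidUpgradeR2RotInvPowerLaw.Sketch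

/-- First lemma (to be proved by a stub-worker; all ingredients landed): existence of a normalised,
non-degenerate, translation-invariant, scale-covariant full pointwise limit ⇒ lattice ratio isotropy. -/
def RatioIsotropyOfExistsLimit : Prop :=
  Summit.CriticalPhenomena.Ising3DConformalLimit.Theses.HyperoctahedralRP.ExistsScaleCovariantLimit →
    Filter.Tendsto (fun x : Literature.Probability.LatticeModels.Site 3 =>
      Literature.Probability.LatticeModels.criticalTwoPoint 3 x /
        Literature.Probability.LatticeModels.criticalTwoPoint 3
          (Pi.single 0 ((⌊Real.sqrt (∑ i, ((x i : ℝ)) ^ 2)⌋₊ : ℕ) : ℤ))) Filter.cofinite (nhds 1)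

/-- Same-mesh comparison (pure bookkeeping over the limit, provable now): at mesh `δ = 1/|y|₂` the lattice
images of the unit vector `y/|y|₂` and of the axis point `(⌊|y|₂⌋/|y|₂)·e₀` are EXACTLY `y` and `⌊|y|₂⌋e₀`, so one
and the same renormalisation `ρ(1/|y|₂)²` controls both `⟨σ₀σ_y⟩` and `⟨σ₀σ_{⌊|y|₂⌋e₀}⟩` (no regular variation
of `ρ` is needed). -/
def SameMeshComparison : Prop :=
  ∀ (ρ : ℝ → ℝ) (S : Literature.Probability.LatticeModels.CorrFamily 3),
    (∀ δ ∈ Set.Ioc (0:ℝ) 1, 0 < ρ δ) →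
    Literature.Probability.LatticeModels.HasPointwiseScalingLimit (Literature.Probability.LatticeModels.criticalCorr 3) ρ S →
    Filter.Tendsto (fun y : Literature.Probability.LatticeModels.Site 3 =>
      ρ (1 / Real.sqrt (∑ i, ((y i : ℝ)) ^ 2)) ^ 2 * Literature.Probability.LatticeModels.criticalTwoPoint 3 y -
        S 2 ![0, (1 / Real.sqrt (∑ i, ((y i : ℝ)) ^ 2)) • (WithLp.toLp 2 (fun i => (y i : ℝ)) : EuclideanSpace ℝ (Fin 3))])
      Filter.cofinite (nhds 0) ∧
    Filter.Tendsto (fun y : Literature.Probability.LatticeModels.Site 3 =>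
      ρ (1 / Real.sqrt (∑ i, ((y i : ℝ)) ^ 2)) ^ 2 *
          Literature.Probability.LatticeModels.criticalTwoPoint 3 (Pi.single 0 ((⌊Real.sqrt (∑ i, ((y i : ℝ)) ^ 2)⌋₊ : ℕ) : ℤ)) -
        S 2 ![0, ((⌊Real.sqrt (∑ i, ((y i : ℝ)) ^ 2)⌋₊ : ℝ) / Real.sqrt (∑ i, ((y i : ℝ)) ^ 2)) • EuclideanSpace.single 0 1])
      Filter.cofinite (nhds 0)

end Summit.CriticalPhenomena.Ising3DConformalLimit.Cruxes.IsingEuclidUpgradeR2RotInvPowerLaw.Sketch
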